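import Literature.Topology.FourManifolds.Bordism
import Literature.Topology.FourManifolds.DisjointSpheresSlab
import Literature.Topology.FourManifolds.MorseCountClosed
import Literature.AlgebraicTopology.SingularHomology.CompactManifoldFiniteness
import Literature.AlgebraicTopology.SingularHomology.FundamentalClassProofs
import Mathlib.LinearAlgebra.Dimension.Localization
import HarnessLib

/-!
# The Euler characteristic modulo `2` is an invariant of unoriented bordism

Topic `Literature/Topology/FourManifolds` (fact seat
`provefact-Literature.Topology.FourManifolds.unorientedBordismClass_mk_complexProjectivePlane_ne_zero`;
consumed by `BordismFourUnorientedProofs.lean`).  Everything here is **proved**; no definition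
and no named fact is introduced.

**Theorem** (classical; R. Thom, Comment. Math. Helv. 28 (1954), Ch. IV, with
Milnor–Stasheff, *Characteristic classes* (1974), Thm. 4.9 (Pontrjagin: a closed manifold that
bounds a compact manifold has zero Stiefel–Whitney numbers) and Cor. 11.12 (`w_n[M] = χ(M)
mod 2`)): *if the closed smooth `n`-manifolds `M`, `N` are cobordant, then
`χ(M) ≡ χ(N) (mod 2)`; in particular the Euler characteristic modulo `2` is well defined on
the unoriented bordism group `𝔑ₙ` and vanishes on the class `0`.*

## The proof given here (Morse-theoretic, from proved inputs of the tree)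

Let `(W; V, V')` be a cobordism from `M` to `N` (`Literature.Topology.FourManifolds.Cobordism`, `V = inl M ≅ M`,
`V' = inr N ≅ N`).

1. `Cobordism.morseCount_inl_inr`: `W` carries a *nice* Morse function `g` (Milnor, *Lectures
   on the h-cobordism theorem* (1965), Thm. 2.5 and Thm. 4.8 — the tree's **proved**
   `Cobordism.exists_isMorseFunction_holds` and `Cobordism.Milnor1965_finalRearrangement_holds`),
   and the Morse count (M. Hirsch, *Differential Topology* (1976), Ch. 6 §3 Thm. 3.4 (b) — the
   tree's **proved** `Cobordism.IsNiceMorseFunction.morseCount`) computes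
   `χ(W, V) = Σ_k (-1)^k #Crit_k(g)` and, for the turned-about function `1 - g` on `(W; V', V)`
   (indices `k ↦ n + 1 - k`, Milnor 1965, proof of Thm. 9.1), `χ(W, V') = (-1)^{n+1} χ(W, V)`;
   here `χ(W, V) = Σ_{i<n+2} (-1)^i rank H_i(W, V; ℤ)`, all groups finitely generated and zero
   from degree `n + 2` on.
2. `sum_finrank_singularHomology_eq_of_pair`: rank–nullity along the long exact sequence of the
   pair (Hatcher, *Algebraic Topology* (2002), Thm. 2.13 ff. — the tree's **proved**
   `relativeSingularHomology.exact_map_ofAbsolute` / `exact_ofAbsolute_δ` / `exact_δ_map`;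
   §2.2, proof of Thm. 2.44) gives `χ(W) = χ(V) + χ(W, V)` as soon as `H_•(V)` and `H_•(W, V)` are
   finitely generated and bounded — which holds by Hatcher Cor. A.8–A.9 and Thm. 3.26 (the
   tree's **proved** `finite_singularHomology_of_compactSpace_holds`,
   `isZero_singularHomology_of_lt_holds`) and step 1.
3. `Cobordism.even_eulerSum_sub`: hence `χ(M) - χ(N) = χ(W, V') - χ(W, V) = ((-1)^{n+1} - 1) χ(W, V)`
   is even (`χ(V) = χ(M)` along the homeomorphism `M ≅ V`, `singularHomology.mapIso`).
4. `BordismClass.intCast_eulerChar_eq_of_mk_eq_mk`,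
   `UnorientedBordismClass.intCast_eulerChar_eq_zero_of_mk_eq_zero`: induction along the
   equivalence closure of `ClosedSingularManifold.IsBordant` defining the quotient
   `Literature.Topology.FourManifolds.BordismClass` (`Bordism.lean`); the empty manifold has `χ = 0`.

The Euler characteristic is written as the explicit finite sum
`Σ_{i ≤ n} (-1)^i rank_ℤ H_i(M; ℤ)` of ranks of Mathlib/`Literature` singular homology
(`Literature.AlgebraicTopology.SingularHomology.singularHomology`); the tree's `relEuler`
(`EulerCharacteristicTriple.lean`) is deliberately not used: that module and the Morse modules
imported here cannot be imported together (both `…UniverseTransportIso` and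
`…RelativeUniverseTransport` declare `SingularSimplex.range_push`), so the rank bookkeeping of
the pair sequence is redone in `§ Pair` below in the generality of a Noetherian coefficient ring
with rank–nullity.

## References

* R. Thom, *Quelques propriétés globales des variétés différentiables*, Comment. Math. Helv. 28
  (1954), 17–86, Ch. IV. [ThomCMH1954]
* J. Milnor, J. Stasheff, *Characteristic classes*, Ann. of Math. Studies 76 (1974), §4
  Thm. 4.9, §11 Cor. 11.12, §17. [MilnorStasheffAMS76]
* M. W. Hirsch, *Differential Topology*, GTM 33 (1976), Ch. 6 §3, Thms. 3.4–3.6. [HirschDT1976]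
* J. Milnor, *Lectures on the h-cobordism theorem* (1965), Thms. 2.5, 4.8, proof of Thm. 9.1.
  [MilnorHCobordism1965]
* A. Hatcher, *Algebraic Topology* (2002), §2.1 Thm. 2.13 ff., §2.2 Thm. 2.44. [HatcherAT2002]
-/

open Set Function CategoryTheory Limits
open scoped Manifold ContDiff
open Literature.AlgebraicTopology.SingularHomology

noncomputable section

namespace Literature.Topology.FourManifolds

universe u

/-! ### The Euler characteristic along the long exact sequence of a pair -/

section Pair

universe v

variable (R : Type v) [CommRing R] {X : Type u} [TopologicalSpace X]

/-- In degree `0` the map `j_* : H₀(X) ⟶ H₀(X, A)` of the pair sequence is onto (the sequence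
ends with `H₀(X) → H₀(X, A) → 0`: the quotient map of chain complexes is an epimorphism and
degree `0` has no outgoing differential). [cite: HatcherAT2002, §2.1, Thm. 2.13 ff. (exact sequence of a pair)] -/
theorem relativeSingularHomology.epi_ofAbsolute_zero (A : Set X) :
    Epi (relativeSingularHomology.ofAbsolute R R X A 0) := by
  haveI := relativeSingularChainComplex.epi_π R R (X := X) A
  exact HomologicalComplex.epi_homologyMap_of_epi_of_not_rel _ 0 (fun j hj => by
    simp only [ComplexShape.down_Rel] at hj; omega)

/-- **The Euler characteristic along the long exact sequence of the pair `(X, A)`** (Hatcher,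
*Algebraic Topology* (2002), §2.1 Thm. 2.13 ff. and §2.2, proof of Thm. 2.44: "the alternating
sum of ranks is additive along exact sequences of finitely generated groups"; Spanier (1966),
Ch. 4 §3 Thm. 14).  If `H_k(A; ℤ)` and `H_k(X, A; ℤ)` are finitely generated for all `k` and
vanish for `k ≥ N`, then so does `H_k(X; ℤ)`, and
`Σ_{k<N} (-1)^k rank H_k(X) = Σ_{k<N} (-1)^k rank H_k(A) + Σ_{k<N} (-1)^k rank H_k(X, A)`.
Proof: rank–nullity at every spot of
`⋯ → H_k(A) →i H_k(X) →j H_k(X, A) →∂ H_{k-1}(A) → ⋯ → H₀(X, A) → 0`; the alternating sum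
telescopes to `± rank im ∂_N = 0`. [cite: HatcherAT2002, §2.2, Thm. 2.44 (proof)] -/
theorem sum_finrank_singularHomology_eq_of_pair [IsNoetherianRing R] [HasRankNullity.{max u v} R]
    (A : Set X) (N : ℕ)
    (hAf : ∀ k, Module.Finite R (singularHomology R R A k))
    (hAz : ∀ k, N ≤ k → IsZero (singularHomology R R A k))
    (hCf : ∀ k, Module.Finite R (relativeSingularHomology R R X A k))
    (hCz : ∀ k, N ≤ k → IsZero (relativeSingularHomology R R X A k)) :
    (∀ k, Module.Finite R (singularHomology R R X k)) ∧
    (∀ k, N ≤ k → IsZero (singularHomology R R X k)) ∧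
    ∑ k ∈ Finset.range N, (-1 : ℤ) ^ k * (Module.finrank R (singularHomology R R X k) : ℤ) =
      ∑ k ∈ Finset.range N, (-1 : ℤ) ^ k * (Module.finrank R (singularHomology R R A k) : ℤ) +
      ∑ k ∈ Finset.range N, (-1 : ℤ) ^ k *
        (Module.finrank R (relativeSingularHomology R R X A k) : ℤ) := by
  haveI : Nontrivial R := nontrivial_of_hasRankNullity.{max u v} R
  -- algebra: along an exact `X₁ ⟶ X₂ ⟶ X₃`, finite generation of the middle term and
  -- rank–nullity `rank X₂ = rank (im f) + rank (im g)`; the rank of the image of an epimorphism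
  -- and of a morphism out of a zero object
  have finrank_mid : ∀ {S : ShortComplex (ModuleCat.{max u v} R)}, S.Exact → Module.Finite R S.X₂ →
      (Module.finrank R S.X₂ : ℤ) = Module.finrank R (LinearMap.range S.f.hom) +
        Module.finrank R (LinearMap.range S.g.hom) := fun {S} hS _ => by
    have h1 := Submodule.finrank_quotient_add_finrank (LinearMap.ker S.g.hom)
    rw [LinearEquiv.finrank_eq S.g.hom.quotKerEquivRange, ← hS.moduleCat_range_eq_ker] at h1
    omega
  have finite_mid : ∀ {S : ShortComplex (ModuleCat.{max u v} R)}, S.Exact →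
      Module.Finite R S.X₁ → Module.Finite R S.X₃ → Module.Finite R S.X₂ :=
    fun {S} hS _ _ => by
      haveI : IsNoetherian R S.X₂ :=
        isNoetherian_of_range_eq_ker S.f.hom S.g.hom hS.moduleCat_range_eq_ker
      exact Module.IsNoetherian.finite R _
  have finrank_range_of_epi : ∀ {P Q : ModuleCat.{max u v} R} (φ : P ⟶ Q), Epi φ →
      Module.finrank R (LinearMap.range φ.hom) = Module.finrank R Q := fun φ _ => by
    rw [LinearMap.range_eq_top.2 ((ModuleCat.epi_iff_surjective φ).1 inferInstance), finrank_top]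
  have finrank_range_of_isZero : ∀ {P Q : ModuleCat.{max u v} R} (φ : P ⟶ Q), IsZero P →
      Module.finrank R (LinearMap.range φ.hom) = 0 := fun φ hP => by
    haveI := ModuleCat.subsingleton_of_isZero hP
    have hr : LinearMap.range φ.hom = ⊥ := by
      rw [LinearMap.range_eq_bot]
      ext x
      rw [Subsingleton.elim x 0, map_zero, LinearMap.zero_apply]
    rw [hr, finrank_bot]
  -- the three families of short exact pieces of the long exact sequence of the pair
  have ex₂ := relativeSingularHomology.exact_map_ofAbsolute R R (X := X) A
  have ex₃ := relativeSingularHomology.exact_ofAbsolute_δ R R (X := X) A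
  have ex₁ := relativeSingularHomology.exact_δ_map R R (X := X) A
  -- finite generation of the middle terms
  have hBf : ∀ k, Module.Finite R (singularHomology R R X k) := fun k =>
    finite_mid (ex₂ k) (hAf k) (hCf k)
  have hBz : ∀ k, N ≤ k → IsZero (singularHomology R R X k) := fun k hk =>
    (ex₂ k).isZero_of_both_zeros ((hAz k hk).eq_of_src _ _) ((hCz k hk).eq_of_tgt _ _)
  refine ⟨hBf, hBz, ?_⟩
  -- ranks of the images of `∂` and `j`
  set rd : ℕ → ℤ := fun k =>
    Module.finrank R (LinearMap.range (relativeSingularHomology.δ R R X A k).hom) with hrd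
  set rj : ℕ → ℤ := fun k =>
    Module.finrank R (LinearMap.range (relativeSingularHomology.ofAbsolute R R X A k).hom) with hrj
  set ri : ℕ → ℤ := fun k =>
    Module.finrank R (LinearMap.range (singularHomology.map R R
      (⟨Subtype.val, continuous_subtype_val⟩ : C(A, X)) k).hom) with hri
  have hA : ∀ k, (Module.finrank R (singularHomology R R A k) : ℤ) = rd k + ri k := fun k =>
    finrank_mid (ex₁ k) (hAf k)
  have hB : ∀ k, (Module.finrank R (singularHomology R R X k) : ℤ) = ri k + rj k := fun k =>
    finrank_mid (ex₂ k) (hBf k)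
  have hC : ∀ k, (Module.finrank R (relativeSingularHomology R R X A (k + 1)) : ℤ) =
      rj (k + 1) + rd k := fun k =>
    finrank_mid (ex₃ k) (hCf (k + 1))
  have hC0 : (Module.finrank R (relativeSingularHomology R R X A 0) : ℤ) = rj 0 := by
    haveI := relativeSingularHomology.epi_ofAbsolute_zero R (X := X) A
    simp only [hrj]
    exact_mod_cast (finrank_range_of_epi (relativeSingularHomology.ofAbsolute R R X A 0)
      inferInstance).symm
  -- pointwise: `b k = a k + c k - (rd k + (c k - rj k))`
  have key : ∀ k, (-1 : ℤ) ^ k * (Module.finrank R (singularHomology R R X k) : ℤ) =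
      (-1 : ℤ) ^ k * (Module.finrank R (singularHomology R R A k) : ℤ) +
        (-1 : ℤ) ^ k * (Module.finrank R (relativeSingularHomology R R X A k) : ℤ) -
        ((-1 : ℤ) ^ k * rd k + (-1 : ℤ) ^ k *
          ((Module.finrank R (relativeSingularHomology R R X A k) : ℤ) - rj k)) := by
    intro k
    rw [hA k, hB k]
    ring
  have hsum : ∑ k ∈ Finset.range N, (-1 : ℤ) ^ k * (Module.finrank R (singularHomology R R X k) : ℤ) =
      ∑ k ∈ Finset.range N, (-1 : ℤ) ^ k * (Module.finrank R (singularHomology R R A k) : ℤ) +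
      ∑ k ∈ Finset.range N, (-1 : ℤ) ^ k *
        (Module.finrank R (relativeSingularHomology R R X A k) : ℤ) -
      ((∑ k ∈ Finset.range N, (-1 : ℤ) ^ k * rd k) +
        ∑ k ∈ Finset.range N, (-1 : ℤ) ^ k *
          ((Module.finrank R (relativeSingularHomology R R X A k) : ℤ) - rj k)) := by
    rw [← Finset.sum_add_distrib, ← Finset.sum_add_distrib, ← Finset.sum_sub_distrib]
    exact Finset.sum_congr rfl fun k _ => key k
  rw [hsum, sub_eq_self]
  -- `c 0 - rj 0 = 0`, `c (k+1) - rj (k+1) = rd k`, `rd (N - 1) = 0`: the sum telescopes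
  cases N with
  | zero => simp
  | succ m =>
    have h0 : (Module.finrank R (relativeSingularHomology R R X A 0) : ℤ) - rj 0 = 0 := by
      rw [hC0]; exact sub_self _
    have hS : ∀ k, (Module.finrank R (relativeSingularHomology R R X A (k + 1)) : ℤ) -
        rj (k + 1) = rd k := fun k => by
      rw [hC k]; ring
    have hlast : rd m = 0 := by
      show (Module.finrank R (LinearMap.range (relativeSingularHomology.δ R R X A m).hom) : ℤ) = 0
      exact_mod_cast finrank_range_of_isZero _ (hCz (m + 1) le_rfl)
    rw [Finset.sum_range_succ, Finset.sum_range_succ', h0, mul_zero, add_zero, hlast, mul_zero,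
      add_zero]
    have hS' : ∑ k ∈ Finset.range m, (-1 : ℤ) ^ (k + 1) *
        ((Module.finrank R (relativeSingularHomology R R X A (k + 1)) : ℤ) - rj (k + 1)) =
        ∑ k ∈ Finset.range m, -((-1 : ℤ) ^ k * rd k) := by
      refine Finset.sum_congr rfl fun k _ => ?_
      rw [hS k, pow_succ]
      ring
    rw [hS', Finset.sum_neg_distrib]
    exact add_neg_cancel _

end Pair


/-! ### Cobordisms: the Morse count from both ends -/

section Cobordism

variable {n : ℕ} {M N : Type u} [TopologicalSpace M] [T2Space M] [SecondCountableTopology M]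
  [ChartedSpace (EuclideanSpace ℝ (Fin n)) M] [IsManifold (𝓡 n) ∞ M] [CompactSpace M]
  [TopologicalSpace N] [T2Space N] [SecondCountableTopology N] [ChartedSpace (EuclideanSpace ℝ (Fin n)) N]
  [IsManifold (𝓡 n) ∞ N] [CompactSpace N]

/-- **The Morse count of a cobordism read from both ends.**  For a cobordism `(W; V, V')`
between closed `n`-manifolds (`V = inl M`, `V' = inr N`), the groups `H_i(W, V; ℤ)` and
`H_i(W, V'; ℤ)` are finitely generated, vanish for `i ≥ n + 2`, and
`Σ_{i<n+2} (-1)^i rank H_i(W, V') = (-1)^{n+1} Σ_{i<n+2} (-1)^i rank H_i(W, V)`.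
Proof: a nice Morse function `g` on `(W; V, V')` exists (Milnor 1965, Thm. 2.5 and Thm. 4.8 —
the tree's `Cobordism.exists_isMorseFunction_holds`, `Cobordism.Milnor1965_finalRearrangement_holds`);
both counts are Morse counts (Hirsch 1976, Ch. 6 §3 Thm. 3.4 (b), the tree's
`Cobordism.IsNiceMorseFunction.morseCount`), for `g` and for the turned-about function `1 - g` on
`(W; V', V)`, whose critical points of index `k` are those of index `n + 1 - k` of `g`
(Milnor 1965, proof of Thm. 9.1). [cite: HirschDT1976, Ch. 6 §3, Thms. 3.4–3.6 (PDF p. 151)] -/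
theorem Cobordism.morseCount_inl_inr (c : Cobordism n M N) :
    (∀ i, Module.Finite ℤ (relativeSingularHomology ℤ ℤ c.W (range c.inl) i)) ∧
    (∀ i, n + 2 ≤ i → IsZero (relativeSingularHomology ℤ ℤ c.W (range c.inl) i)) ∧
    (∀ i, Module.Finite ℤ (relativeSingularHomology ℤ ℤ c.W (range c.inr) i)) ∧
    (∀ i, n + 2 ≤ i → IsZero (relativeSingularHomology ℤ ℤ c.W (range c.inr) i)) ∧
    ∑ i ∈ Finset.range (n + 2), (-1 : ℤ) ^ i *
        (Module.finrank ℤ (relativeSingularHomology ℤ ℤ c.W (range c.inr) i) : ℤ) =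
      (-1) ^ (n + 1) * ∑ i ∈ Finset.range (n + 2), (-1 : ℤ) ^ i *
        (Module.finrank ℤ (relativeSingularHomology ℤ ℤ c.W (range c.inl) i) : ℤ) := by
  obtain ⟨f, hf⟩ := Cobordism.exists_isMorseFunction_holds c
  obtain ⟨g, hg, -, -⟩ := Cobordism.Milnor1965_finalRearrangement_holds hf
  obtain ⟨hF₁, hZ₁, hS₁⟩ := hg.morseCount
  have h2 : (∀ i, Module.Finite ℤ (relativeSingularHomology ℤ ℤ c.W (range c.inr) i)) ∧
      (∀ i, n + 2 ≤ i → IsZero (relativeSingularHomology ℤ ℤ c.W (range c.inr) i)) ∧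
      ∑ i ∈ Finset.range (n + 2), (-1 : ℤ) ^ i *
          (Module.finrank ℤ (relativeSingularHomology ℤ ℤ c.W (range c.inr) i) : ℤ) =
        ∑ k ∈ Finset.range (n + 2), (-1 : ℤ) ^ k *
          ((criticalSetOfIndex (𝓡∂ (n + 1)) (fun z => 1 - g z) k).ncard : ℤ) :=
    hg.symm.morseCount
  obtain ⟨hF₂, hZ₂, hS₂⟩ := h2
  refine ⟨hF₁, hZ₁, hF₂, hZ₂, ?_⟩
  rw [hS₂, hS₁]
  have hr : ∀ k ∈ Finset.range (n + 2), (-1 : ℤ) ^ k *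
      ((criticalSetOfIndex (𝓡∂ (n + 1)) (fun z => 1 - g z) k).ncard : ℤ) =
      (-1) ^ (n + 1) * ((-1 : ℤ) ^ (n + 2 - 1 - k) *
        ((criticalSetOfIndex (𝓡∂ (n + 1)) g (n + 2 - 1 - k)).ncard : ℤ)) := by
    intro k hk
    have hk' : k ≤ n + 1 := by
      have := Finset.mem_range.1 hk
      omega
    rw [hg.isMorseFunction.criticalSetOfIndex_one_sub hk', show n + 2 - 1 - k = n + 1 - k by omega,
      ← mul_assoc, ← pow_add, show n + 1 + (n + 1 - k) = 2 * (n + 1 - k) + k by omega, pow_add,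
      pow_mul]
    norm_num
  rw [Finset.sum_congr rfl hr, ← Finset.mul_sum, Finset.sum_range_reflect (fun k => (-1 : ℤ) ^ k *
    ((criticalSetOfIndex (𝓡∂ (n + 1)) g k).ncard : ℤ)) (n + 2)]

/-- **The Euler characteristics of cobordant closed manifolds have the same parity.**  If the
closed smooth `n`-manifolds `M`, `N` are the two ends of a compact smooth cobordism `W`, then
`χ(M) - χ(N)` is even, where `χ(M) = Σ_{i ≤ n} (-1)^i rank H_i(M; ℤ)` (written as a sum over
`i < n + 2`; the terms of degree `> n` vanish).  Classical (the boundary of a compact manifold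
has even Euler characteristic; e.g. Milnor–Stasheff, *Characteristic classes* (1974), Cor. 11.12
with Thm. 4.9, through `χ ≡ w_n mod 2`); proved here through the long exact sequences of the
pairs `(W, M)`, `(W, N)` (Hatcher 2002, Thm. 2.13 ff.), which give
`χ(W) = χ(M) + χ(W, M) = χ(N) + χ(W, N)`, and the Morse count from both ends
(`Cobordism.morseCount_inl_inr`): `χ(W, N) = (-1)^{n+1} χ(W, M)`, so that
`χ(M) - χ(N) = ((-1)^{n+1} - 1) χ(W, M)` is even. [cite: MilnorStasheffAMS76, §4 Thm. 4.9 and §11 Cor. 11.12 (χ ≡ w_n[M] mod 2; boundaries have zero Stiefel–Whitney numbers)] -/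
theorem Cobordism.even_eulerSum_sub (c : Cobordism n M N) :
    Even (∑ i ∈ Finset.range (n + 2), (-1 : ℤ) ^ i * (Module.finrank ℤ (singularHomology ℤ ℤ M i) : ℤ) -
      ∑ i ∈ Finset.range (n + 2), (-1 : ℤ) ^ i * (Module.finrank ℤ (singularHomology ℤ ℤ N i) : ℤ)) := by
  obtain ⟨hF₁, hZ₁, hF₂, hZ₂, hS⟩ := c.morseCount_inl_inr
  -- the two ends as subspaces of `W`
  have eM : M ≃ₜ ↥(range c.inl) := c.isSmoothEmbedding_inl.isEmbedding.toHomeomorph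
  have eN : N ≃ₜ ↥(range c.inr) := c.isSmoothEmbedding_inr.isEmbedding.toHomeomorph
  have hMf : ∀ k, Module.Finite ℤ (singularHomology ℤ ℤ M k) := fun k =>
    finite_singularHomology_of_compactSpace_holds (R := ℤ) M n k
  have hNf : ∀ k, Module.Finite ℤ (singularHomology ℤ ℤ N k) := fun k =>
    finite_singularHomology_of_compactSpace_holds (R := ℤ) N n k
  have hMz : ∀ k, n + 2 ≤ k → IsZero (singularHomology ℤ ℤ M k) := fun k hk =>
    isZero_singularHomology_of_lt_holds (R := ℤ) (M := ℤ) (X := M) n (by omega)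
  have hNz : ∀ k, n + 2 ≤ k → IsZero (singularHomology ℤ ℤ N k) := fun k hk =>
    isZero_singularHomology_of_lt_holds (R := ℤ) (M := ℤ) (X := N) n (by omega)
  have hAf : ∀ k, Module.Finite ℤ (singularHomology ℤ ℤ ↥(range c.inl) k) := fun k => by
    haveI := hMf k
    exact Module.Finite.equiv (singularHomology.mapIso ℤ ℤ eM k).toLinearEquiv
  have hBf : ∀ k, Module.Finite ℤ (singularHomology ℤ ℤ ↥(range c.inr) k) := fun k => by
    haveI := hNf k
    exact Module.Finite.equiv (singularHomology.mapIso ℤ ℤ eN k).toLinearEquiv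
  have hAz : ∀ k, n + 2 ≤ k → IsZero (singularHomology ℤ ℤ ↥(range c.inl) k) := fun k hk =>
    (hMz k hk).of_iso (singularHomology.mapIso ℤ ℤ eM k).symm
  have hBz : ∀ k, n + 2 ≤ k → IsZero (singularHomology ℤ ℤ ↥(range c.inr) k) := fun k hk =>
    (hNz k hk).of_iso (singularHomology.mapIso ℤ ℤ eN k).symm
  obtain ⟨-, -, hWM⟩ := sum_finrank_singularHomology_eq_of_pair ℤ (range c.inl) (n + 2) hAf hAz hF₁ hZ₁
  obtain ⟨-, -, hWN⟩ := sum_finrank_singularHomology_eq_of_pair ℤ (range c.inr) (n + 2) hBf hBz hF₂ hZ₂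
  have hrM : ∀ k, (Module.finrank ℤ (singularHomology ℤ ℤ ↥(range c.inl) k) : ℤ) =
      Module.finrank ℤ (singularHomology ℤ ℤ M k) := fun k =>
    congrArg Nat.cast (singularHomology.mapIso ℤ ℤ eM k).toLinearEquiv.finrank_eq.symm
  have hrN : ∀ k, (Module.finrank ℤ (singularHomology ℤ ℤ ↥(range c.inr) k) : ℤ) =
      Module.finrank ℤ (singularHomology ℤ ℤ N k) := fun k =>
    congrArg Nat.cast (singularHomology.mapIso ℤ ℤ eN k).toLinearEquiv.finrank_eq.symm
  simp_rw [hrM] at hWM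
  simp_rw [hrN] at hWN
  set S := ∑ i ∈ Finset.range (n + 2), (-1 : ℤ) ^ i *
    (Module.finrank ℤ (relativeSingularHomology ℤ ℤ c.W (range c.inl) i) : ℤ) with hSdef
  have key : ∑ i ∈ Finset.range (n + 2), (-1 : ℤ) ^ i * (Module.finrank ℤ (singularHomology ℤ ℤ M i) : ℤ) -
      ∑ i ∈ Finset.range (n + 2), (-1 : ℤ) ^ i * (Module.finrank ℤ (singularHomology ℤ ℤ N i) : ℤ) =
      ((-1) ^ (n + 1) - 1) * S := by
    linear_combination hWN - hWM + hS
  rw [key]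
  exact (Odd.sub_odd (Odd.pow (by decide)) odd_one).mul_right _

/-- The same with the Euler characteristic written as the sum over the degrees `0, …, n`:
**cobordant closed `n`-manifolds have Euler characteristics of the same parity.**
[cite: MilnorStasheffAMS76, §4 Thm. 4.9 and §11 Cor. 11.12 (χ ≡ w_n[M] mod 2; boundaries have zero Stiefel–Whitney numbers)] -/
theorem Cobordism.even_eulerChar_sub (c : Cobordism n M N) :
    Even (∑ i ∈ Finset.range (n + 1), (-1 : ℤ) ^ i * (Module.finrank ℤ (singularHomology ℤ ℤ M i) : ℤ) -
      ∑ i ∈ Finset.range (n + 1), (-1 : ℤ) ^ i * (Module.finrank ℤ (singularHomology ℤ ℤ N i) : ℤ)) := by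
  have h := c.even_eulerSum_sub
  have hM : Module.finrank ℤ (singularHomology ℤ ℤ M (n + 1)) = 0 :=
    (Cobordism.finite_and_finrank_eq_zero_of_isZero
      (isZero_singularHomology_of_lt_holds (R := ℤ) (M := ℤ) (X := M) n (Nat.lt_succ_self n))).2
  have hN : Module.finrank ℤ (singularHomology ℤ ℤ N (n + 1)) = 0 :=
    (Cobordism.finite_and_finrank_eq_zero_of_isZero
      (isZero_singularHomology_of_lt_holds (R := ℤ) (M := ℤ) (X := N) n (Nat.lt_succ_self n))).2
  rw [Finset.sum_range_succ _ (n + 1), Finset.sum_range_succ _ (n + 1), hM, hN] at h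
  simpa only [Nat.cast_zero, mul_zero, add_zero] using h

/-- **Cobordant closed manifolds have Euler characteristics of the same parity** — the
relation `IsCobordant`. [cite: MilnorStasheffAMS76, §4 Thm. 4.9 and §11 Cor. 11.12 (χ ≡ w_n[M] mod 2; boundaries have zero Stiefel–Whitney numbers)] -/
theorem IsCobordant.even_eulerChar_sub (h : IsCobordant n M N) :
    Even (∑ i ∈ Finset.range (n + 1), (-1 : ℤ) ^ i * (Module.finrank ℤ (singularHomology ℤ ℤ M i) : ℤ) -
      ∑ i ∈ Finset.range (n + 1), (-1 : ℤ) ^ i * (Module.finrank ℤ (singularHomology ℤ ℤ N i) : ℤ)) := by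
  obtain ⟨c⟩ := h
  exact c.even_eulerChar_sub

end Cobordism

/-! ### Bordism classes: the Euler characteristic modulo `2` -/

section Bordism

variable {Y : Type*} [TopologicalSpace Y] {n : ℕ}

/-- **Bordant singular manifolds have Euler characteristics of the same parity.**
[cite: MilnorStasheffAMS76, §4 Thm. 4.9 and §11 Cor. 11.12 (χ ≡ w_n[M] mod 2; boundaries have zero Stiefel–Whitney numbers)] -/
theorem ClosedSingularManifold.IsBordant.even_eulerChar_sub {s t : ClosedSingularManifold.{u} Y n}
    (h : s.IsBordant t) :
    Even (∑ i ∈ Finset.range (n + 1), (-1 : ℤ) ^ i * (Module.finrank ℤ (singularHomology ℤ ℤ s.M i) : ℤ) -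
      ∑ i ∈ Finset.range (n + 1), (-1 : ℤ) ^ i * (Module.finrank ℤ (singularHomology ℤ ℤ t.M i) : ℤ)) := by
  obtain ⟨c, -, -, -⟩ := h
  haveI := c.isSmoothEmbedding_inl.isEmbedding.secondCountableTopology
  haveI := c.isSmoothEmbedding_inr.isEmbedding.secondCountableTopology
  exact c.even_eulerChar_sub

/-- **The Euler characteristic modulo `2` is an invariant of the bordism class**: singular
manifolds with the same class in `𝔑ₙ(Y)` have `χ ≡ χ' (mod 2)` (Thom 1954, Ch. IV; Milnor–Stasheff
(1974), §4 Thm. 4.9 / §17: Stiefel–Whitney numbers — in particular `w_n[M] = χ(M) mod 2`,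
Cor. 11.12 — are bordism invariants).  Obtained by induction along the equivalence closure of
`IsBordant` defining the quotient `BordismClass`. [cite: MilnorStasheffAMS76, §4 Thm. 4.9 and §11 Cor. 11.12 (χ ≡ w_n[M] mod 2; boundaries have zero Stiefel–Whitney numbers)] -/
theorem BordismClass.intCast_eulerChar_eq_of_mk_eq_mk {s t : ClosedSingularManifold.{u} Y n}
    (h : BordismClass.mk s = BordismClass.mk t) :
    ((∑ i ∈ Finset.range (n + 1), (-1 : ℤ) ^ i *
        (Module.finrank ℤ (singularHomology ℤ ℤ s.M i) : ℤ) : ℤ) : ZMod 2) =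
      ((∑ i ∈ Finset.range (n + 1), (-1 : ℤ) ^ i *
        (Module.finrank ℤ (singularHomology ℤ ℤ t.M i) : ℤ) : ℤ) : ZMod 2) := by
  have hgen := Quot.eqvGen_exact h
  clear h
  induction hgen with
  | rel x y hxy =>
    obtain ⟨r, hr⟩ := ClosedSingularManifold.IsBordant.even_eulerChar_sub hxy
    rw [sub_eq_iff_eq_add] at hr
    rw [hr]
    push_cast
    rw [CharTwo.add_self_eq_zero, zero_add]
  | refl x => rfl
  | symm x y _ ih => exact ih.symm
  | trans x y z _ _ ih₁ ih₂ => exact ih₁.trans ih₂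

/-- **A closed manifold whose unoriented bordism class vanishes has even Euler characteristic**
(Thom 1954, Ch. IV; Milnor–Stasheff (1974), Thm. 4.9: a closed manifold bounding a compact
manifold has vanishing Stiefel–Whitney numbers, in particular `w_n[M] = χ(M) mod 2 = 0`).
[cite: MilnorStasheffAMS76, §4 Thm. 4.9 and §11 Cor. 11.12 (χ ≡ w_n[M] mod 2; boundaries have zero Stiefel–Whitney numbers)] -/
theorem UnorientedBordismClass.intCast_eulerChar_eq_zero_of_mk_eq_zero (M : Type u)
    [TopologicalSpace M] [T2Space M] [ChartedSpace (EuclideanSpace ℝ (Fin n)) M] [IsManifold (𝓡 n) ∞ M] [CompactSpace M]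
    [BoundarylessManifold (𝓡 n) M]
    (h : UnorientedBordismClass.mk M = (0 : UnorientedBordismClass.{u} n)) :
    ((∑ i ∈ Finset.range (n + 1), (-1 : ℤ) ^ i *
        (Module.finrank ℤ (singularHomology ℤ ℤ M i) : ℤ) : ℤ) : ZMod 2) = 0 := by
  have h0 : BordismClass.mk (ClosedSingularManifold.ofManifold n M) =
      BordismClass.mk (ClosedSingularManifold.empty.{u} PUnit.{u + 1} n) := h
  have h1 := BordismClass.intCast_eulerChar_eq_of_mk_eq_mk h0
  -- the empty singular manifold: all homology vanishes
  have hz : ∀ i, IsZero (singularHomology ℤ ℤ (ClosedSingularManifold.empty.{u} PUnit.{u + 1} n).M i) := by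
    intro i
    haveI := relativeSingularHomology.isIso_ofAbsolute_of_isEmpty ℤ ℤ
      (X := (ClosedSingularManifold.empty.{u} PUnit.{u + 1} n).M) (univ : Set _) i
    exact (isZero_relativeSingularHomology_univ ℤ ℤ i).of_iso
      (asIso (relativeSingularHomology.ofAbsolute ℤ ℤ _ univ i))
  have h2 : ((∑ i ∈ Finset.range (n + 1), (-1 : ℤ) ^ i * (Module.finrank ℤ (singularHomology ℤ ℤ
        (ClosedSingularManifold.empty.{u} PUnit.{u + 1} n).M i) : ℤ) : ℤ) : ZMod 2) = 0 := by
    rw [Finset.sum_eq_zero fun i _ => by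
      rw [(Cobordism.finite_and_finrank_eq_zero_of_isZero (hz i)).2, Nat.cast_zero, mul_zero]]
    simp
  rw [h2] at h1
  exact h1

end Bordism

end Literature.Topology.FourManifolds
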